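import Summits.KontsevichZagierPeriods.KontsevichZagierPeriods.Theses.HermiteRigidity
import Summits.KontsevichZagierPeriods.KontsevichZagierPeriods.Theorems.HermiteRigidityReductionRigidityLineReduction
import Summits.KontsevichZagierPeriods.KontsevichZagierPeriods.Theorems.HurwitzMicroSectorsNormalFormPrincipleBoxSplitCertK8
import Literature.NumberTheory.Transcendental.KZKernelConjectureForms

/-!
# STUB-PLAN companion (stub critic) — `stub_islandComplement` of crux `ReductionRigidity`
# (stmt-KontsevichZagierPeriods-3407; item form stmt-15935 `IslandComplement`)

Elaboration check of the MERGED helper-lemma list of `STUB-PLAN-stub_islandComplement.md`.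
`§0` is kernel-checked status (no sorry). `§G1` = the multi-level weight-one island: the main
theorem `multiLevelLineKernel_of` is PROVED here from ONE sorried presentation helper
(`helper_G1_presentation`) and the LANDED `box_split_mem_relations` (HurwitzMicroSectors,
NormalFormPrinciple line) — this replaces k2's A1+A2+A3 and k3's H1+H2. `§G2` = weight-two
level-changing moves (statements only). `§B` = the named-fact vending shape (k1 Plan B).
-/

noncomputable section

open MeasureTheory Set
open scoped Polynomial

namespace Summit.KontsevichZagierPeriods.HermiteRigidity.ReductionRigidity.IslandComplementPlan

open Literature.NumberTheory.Transcendental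
open Literature.NumberTheory.Transcendental.KZ
open Summit.KontsevichZagierPeriods.KontsevichZagierPeriods.Theses.HermiteRigidity
  (IslandComplement PadeBoxIslands ReductionRigidity)
open Summit.KontsevichZagierPeriods.HurwitzMicroSectors.NormalFormPrinciple.PiBox.Dlog

/-! ## §0 Status (kernel-checked, no sorry): the stub IS the summit, certified in the tree -/

/-- The skeleton's stub type, written with `KZ.cube n`, is the route item verbatim. -/
example : IslandComplement ↔
    ((∀ (N : ℕ), 2 ≤ N →
      ∀ c ∈ AddSubgroup.closure
        ({c | ∃ (r : IntegralRep 1) (a m : ℕ), r.domain = cube 1 ∧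
            EqOn r.integrand (fun p => p 0 ^ a / ((N : ℝ) - p 0) ^ m) (cube 1) ∧ c = KZ.of r} ∪
         {c | ∃ (r : IntegralRep 0) (q : ℚ), r.domain = cube 0 ∧
            EqOn r.integrand (fun _ => (q : ℝ)) (cube 0) ∧ c = KZ.of r}),
        KZ.eval c = 0 → c ∈ KZ.relations) →
    (∀ (N : ℕ), 2 ≤ N →
      (∀ a b c : ℚ, (a : ℝ) + b * (∫ p in cube 1, 1 / ((N : ℝ) - p 0)) +
          c * (∫ p in cube 2, 1 / ((N : ℝ) - p 0 * p 1)) = 0 → a = 0 ∧ b = 0 ∧ c = 0) →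
      ∀ c ∈ AddSubgroup.closure
        ({c | ∃ (r : IntegralRep 2) (a b m : ℕ), r.domain = cube 2 ∧
            EqOn r.integrand (fun p => p 0 ^ a * p 1 ^ b / ((N : ℝ) - p 0 * p 1) ^ m) (cube 2) ∧
            c = KZ.of r} ∪
         {c | ∃ (r : IntegralRep 1) (a m : ℕ), r.domain = cube 1 ∧
            EqOn r.integrand (fun p => p 0 ^ a / ((N : ℝ) - p 0) ^ m) (cube 1) ∧ c = KZ.of r} ∪
         {c | ∃ (r : IntegralRep 0) (q : ℚ), r.domain = cube 0 ∧
            EqOn r.integrand (fun _ => (q : ℝ)) (cube 0) ∧ c = KZ.of r}),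
        KZ.eval c = 0 → c ∈ KZ.relations) →
    ∀ c : FormalRep, KZ.eval c = 0 → c ∈ KZ.relations) := Iff.rfl

/-- Status, re-derived without importing the (farm-unbuilt) Strength file: the stub is
`PadeBoxIslands → KZKernelConjecture` by currying; `PadeBoxIslands` is PROVED
(`padeBoxIslands_proof`, Theorems/HermiteRigidityPadeBoxIslands.lean) and
`kzKernelConjecture_iff_isRational : KZKernelConjecture ↔ <summit body>`; the landed
Theorems/HermiteRigidityIslandComplementStrength.lean (p117997) packages exactly
`islandComplement_iff_kontsevichZagierPeriods` / `islandComplement_iff_kernelForm`. -/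
theorem islandComplement_iff_imp_kernel :
    IslandComplement ↔ (PadeBoxIslands → KZKernelConjecture) :=
  ⟨fun h hI => h hI.1 hI.2, fun h h₁ h₂ => h ⟨h₁, h₂⟩⟩

/-- … and the kernel form is the summit (tree theorem). -/
example : KZKernelConjecture ↔ _root_.KontsevichZagierPeriods := kzKernelConjecture_iff_isRational

/-- The only arrow INTO the stub: a proof of the kernel form / the summit / `VolumeForm` (3814). -/
example (h : _root_.KontsevichZagierPeriods) : IslandComplement :=
  fun _ _ => kzKernelConjecture_iff_isRational.mpr h

/-! ## §G1 The multi-level weight-one island (UNCONDITIONAL; replaces k2 A1–A3, k3 H1–H2)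

Generators: `[□¹, x^a/(N−x)^m]` for ALL integer levels `N ≥ 2` at once, and the rational constants.
Normal form: ONE slab representation `[(0,1), p/q]` with `q = ∏ᵢ (Nᵢ − X)^{mᵢ}` — `ℚ`-split,
non-vanishing on `[0,1]` — so the landed `box_split_mem_relations` (BoxVanishing, dim 1, `ℚ`-split
denominators; Hermite–Lindemann + unique factorisation, no Baker) finishes. -/

/-- The generator set of the multi-level line sector (all levels `N ≥ 2`) with constants. -/
def lineGensAll : Set FormalRep :=
  {c : FormalRep | ∃ (N : ℕ) (r : IntegralRep 1) (a m : ℕ), 2 ≤ N ∧ r.domain = cube 1 ∧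
      EqOn r.integrand (fun p => p 0 ^ a / ((N : ℝ) - p 0) ^ m) (cube 1) ∧ c = KZ.of r} ∪
   {c | ∃ (r : IntegralRep 0) (q : ℚ), r.domain = cube 0 ∧
      EqOn r.integrand (fun _ => (q : ℝ)) (cube 0) ∧ c = KZ.of r}

/-- "`c` is presented by the slab representation of `p/q`": `q ≠ 0` splits over `ℚ`, does not vanish
on `[0,1]`, and `c ≡ [(0,1), p/q]` modulo `KZ.relations`. -/
def SlabPresented (c : FormalRep) : Prop :=
  ∃ (p q : ℚ[X]) (N : IntegralRep 1), q ≠ 0 ∧ q.Splits ∧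
    (∀ t ∈ Set.Icc (0:ℝ) 1, (Polynomial.aeval t q : ℝ) ≠ 0) ∧
    N.domain = {x | x 0 ∈ Set.Ioo (0:ℝ) 1} ∧
    EqOn N.integrand (fun x => (Polynomial.aeval (x 0) p : ℝ) / Polynomial.aeval (x 0) q) N.domain ∧
    c - of N ∈ relations

/-- **helper G1a (existence of slab representations)**: `[(0,1), p/q]` exists whenever `q ≠ 0` on
`[0,1]` (semialgebraic: `isSemialgebraicFunOn_polynomial_div`; integrable: continuous on the compact
closure). Size S. -/
theorem helper_G1a_exists_slab (p q : ℚ[X]) (hq01 : ∀ t ∈ Set.Icc (0:ℝ) 1, (Polynomial.aeval t q : ℝ) ≠ 0) :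
    ∃ N : IntegralRep 1, N.domain = {x | x 0 ∈ Set.Ioo (0:ℝ) 1} ∧
      N.integrand = fun x => (Polynomial.aeval (x 0) p : ℝ) / Polynomial.aeval (x 0) q := by
  sorry

/-- **helper G1b (generators are slab-presented)**: a line generator `[□¹, x^a/(N−x)^m]` is
`≡ [(0,1), X^a/((C N − X)^m)]` (null boundary `of_sub_of_restrict_mem_relations` +
`of_sub_of_mem_relations_of_eqOn`), and a constant `[pt, q]` is `≡ [(0,1), (C q)/1]`
(`slab_sub_pt_mem_relations` with primitive `q·X`, read backwards). Size S. -/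
theorem helper_G1b_gen_presented : ∀ c ∈ lineGensAll, SlabPresented c := by
  sorry

/-- **helper G1c (presentations add and negate)**: rule 1b on the common domain `(0,1)`:
`[(0,1), p₁/q₁] + [(0,1), p₂/q₂] ≡ [(0,1), (p₁q₂ + p₂q₁)/(q₁q₂)]` (`integrandAddRel`), and
`−[(0,1), p/q] ≡ [(0,1), (−p)/q]`; products/negatives of split non-vanishing `q`'s are split and
non-vanishing (`Polynomial.Splits.mul`). Size S–M. -/
theorem helper_G1c_presented_closed :
    SlabPresented 0 ∧ (∀ x y, SlabPresented x → SlabPresented y → SlabPresented (x + y)) ∧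
      (∀ x, SlabPresented x → SlabPresented (-x)) := by
  sorry

/-- **helper G1 = G1b + G1c by closure induction** (the only statement the prover must supply to
the assembly below; G1a is consumed inside G1b/G1c). -/
theorem helper_G1_presentation
    (hgen : ∀ c ∈ lineGensAll, SlabPresented c)
    (hcl : SlabPresented 0 ∧ (∀ x y, SlabPresented x → SlabPresented y → SlabPresented (x + y)) ∧
      (∀ x, SlabPresented x → SlabPresented (-x))) :
    ∀ c ∈ AddSubgroup.closure lineGensAll, SlabPresented c := by
  intro c hc
  induction hc using AddSubgroup.closure_induction with
  | mem x hx => exact hgen x hx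
  | zero => exact hcl.1
  | add x y _ _ hx hy => exact hcl.2.1 x y hx hy
  | neg x _ hx => exact hcl.2.2 x hx

/-- **G1 ASSEMBLED (kernel-checked): Conjecture 1 in kernel form on the MULTI-LEVEL weight-one box
sector**, from the presentation helper and the LANDED `box_split_mem_relations`. Strictly enlarges
hypothesis (i) of the stub (which is level by level): e.g. the cross-level kernel element
`[□¹,1/(9−x)] − 2[□¹,1/(3−x)] + [□¹,1/(2−x)]` (`9/8 = (3/2)²/2`) is covered. [cite: KontsevichZagier2001, §1.2] -/
theorem multiLevelLineKernel_of
    (hpres : ∀ c ∈ AddSubgroup.closure lineGensAll, SlabPresented c) :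
    ∀ c ∈ AddSubgroup.closure lineGensAll, KZ.eval c = 0 → c ∈ KZ.relations := by
  intro c hc h0
  obtain ⟨p, q, N, hq, hsplit, hq01, hNd, hNi, hcN⟩ := hpres c hc
  have hsound : KZ.eval (c - of N) = 0 :=
    (AddMonoidHom.mem_ker).1 (relations_le_ker_eval_holds hcN)
  have hval : N.value = 0 := by
    rw [map_sub, eval_of, h0, zero_sub, neg_eq_zero] at hsound
    exact hsound
  have hN : of N ∈ relations :=
    BoxSplitCertificate.box_split_mem_relations p q hq hsplit hq01 N hNd hNi hval
  have : c = (c - of N) + of N := by abel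
  rw [this]
  exact relations.add_mem hcN hN

/-! ## §G2 Weight two: the level-changing moves (statements; each ONE prover cycle, cubical API) -/

/-- **H0 `reflectAt`** (k3): the reflection `xᵢ ↦ 1 − xᵢ` of the closed cube is one
`mem_cubicalCovGens` instance (`|det| = 1`). Size S. [cite: KontsevichZagier2001, §1.2 rule (2)] -/
theorem helper_H0_reflectAt {n : ℕ} (i : Fin n) (r r' : IntegralRep n)
    (hr : r.IsTameCube) (hr' : r'.IsTameCube)
    (h : ∀ x ∈ cube n, r.integrand x = r'.integrand (Function.update x i (1 - x i))) :
    of r - of r' ∈ relations := by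
  sorry

/-- **C1 = H3 `boxDuplication`** (k2 = k3): `[□², 1/(M²−xy)] − [□², 2/(M−xy)] + [□², 2/(M+xy)] ∈
relations` (`Li₂(1/M²) = 2Li₂(1/M) + 2Li₂(−1/M)`): the squaring self-map `Φ(x,y) = (x²,y²)` of the
closed cube (`mem_cubicalCovGens`, `|det Φ'| = 4xy`, tame representatives via
`of_sub_of_mem_relations_of_eqOn`) then rule 1b with `4xy/(M²−x²y²) = 2/(M−xy) − 2/(M+xy)`.
Size S–M. [cite: KontsevichZagier2001, §1.2 rules (1), (2)] -/
theorem helper_C1_boxDuplication {M : ℕ} (hM : 2 ≤ M) (r s t : IntegralRep 2)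
    (hr : r.domain = cube 2) (hri : EqOn r.integrand (fun p => 1 / ((M : ℝ) ^ 2 - p 0 * p 1)) (cube 2))
    (hs : s.domain = cube 2) (hsi : EqOn s.integrand (fun p => 2 / ((M : ℝ) - p 0 * p 1)) (cube 2))
    (ht : t.domain = cube 2) (hti : EqOn t.integrand (fun p => 2 / ((M : ℝ) + p 0 * p 1)) (cube 2)) :
    KZ.of r - KZ.of s + KZ.of t ∈ KZ.relations := by
  sorry

/-- **H4 `boxLanden`** (k3): `[□², 2/(N−xy)] − [□², 2/((N−1)+xy)] + [□², 1/((N−x)(N−y))] ∈ relations`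
(`2Li₂(1/N) + 2Li₂(−1/(N−1)) + log²((N−1)/N) = 0`): one dimension-raising cubical Stokes move in
`z = t/N` with the rational regular certificate `E₁ = z/(1−xyz)`, `E₂ = −z/((1−z)+xyz)`,
`E₃ = ½z²/((1−xz)(1−yz))` (faces `x = 0` vanish, faces `x = 1` cancel after one reflection H0),
identities exact-checked by k3 (`certificate_checks_H4_H5.py`, evidence #44 on stmt-3407). Size M.
[cite: KontsevichZagier2001, §1.2 rule (3)] -/
theorem helper_H4_boxLanden {N : ℕ} (hN : 2 ≤ N) (r r' rP : IntegralRep 2)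
    (hr : r.domain = cube 2) (hri : EqOn r.integrand (fun p => 2 / ((N : ℝ) - p 0 * p 1)) (cube 2))
    (hr' : r'.domain = cube 2)
    (hr'i : EqOn r'.integrand (fun p => 2 / (((N : ℝ) - 1) + p 0 * p 1)) (cube 2))
    (hrP : rP.domain = cube 2)
    (hrPi : EqOn rP.integrand (fun p => 1 / (((N : ℝ) - p 0) * ((N : ℝ) - p 1))) (cube 2)) :
    KZ.of r - KZ.of r' + KZ.of rP ∈ KZ.relations := by
  sorry

/-! ## §B Named-fact vending (k1 Plan B): the (2,1/N) islands become unconditional for `N ≥ N₀` -/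

/-- Shape of the named fact to vend in `Literature/NumberTheory/Transcendental/` (planner files the
cite item; the range `N₀` MUST be copied from the opened source: Miladi 2001 ⇒ `N₀ = 11`
[quoted in arXiv:2010.09167, p. 3]; Viola–Zudilin 2018 (Crelle 736) possibly lower; Hata 1990 ⇒ 12). -/
def DilogBoxRigidity (N₀ : ℕ) : Prop :=
  ∀ N : ℕ, N₀ ≤ N → ∀ a b c : ℚ,
    (a : ℝ) + b * (∫ p in cube 1, 1 / ((N : ℝ) - p 0)) +
        c * (∫ p in cube 2, 1 / ((N : ℝ) - p 0 * p 1)) = 0 → a = 0 ∧ b = 0 ∧ c = 0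

/-- **B3 (proved)**: with the fact as hypothesis, the weight-two island at level `N ≥ max N₀ 2` is an
unconditional kernel-form theorem (pure modus ponens; `hI := padeBoxIslands_proof`, landed). -/
theorem boxIslandTwo_of_fact {N₀ : ℕ} (hR : DilogBoxRigidity N₀) (hI : PadeBoxIslands)
    (N : ℕ) (hN₀ : N₀ ≤ N) (hN : 2 ≤ N) :
    ∀ c ∈ AddSubgroup.closure
        ({c | ∃ (r : IntegralRep 2) (a b m : ℕ), r.domain = cube 2 ∧
            EqOn r.integrand (fun p => p 0 ^ a * p 1 ^ b / ((N : ℝ) - p 0 * p 1) ^ m) (cube 2) ∧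
            c = KZ.of r} ∪
         {c | ∃ (r : IntegralRep 1) (a m : ℕ), r.domain = cube 1 ∧
            EqOn r.integrand (fun p => p 0 ^ a / ((N : ℝ) - p 0) ^ m) (cube 1) ∧ c = KZ.of r} ∪
         {c | ∃ (r : IntegralRep 0) (q : ℚ), r.domain = cube 0 ∧
            EqOn r.integrand (fun _ => (q : ℝ)) (cube 0) ∧ c = KZ.of r}),
        KZ.eval c = 0 → c ∈ KZ.relations :=
  hI.2 N hN (hR N hN₀)

end Summit.KontsevichZagierPeriods.HermiteRigidity.ReductionRigidity.IslandComplementPlan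

end
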